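import Mathlib
import HarnessLib
import Summits.Langlands.Statement
import Summits.Langlands.Langlands.Theses.AnchoredInductionCarving
import Summits.Langlands.Langlands.Theses.InsolubleInductionCarving
import Summits.Langlands.Langlands.Theses.WeilRestrictionSplit
import Summits.Langlands.Langlands.Theorems.PolarisationCarvingBoxes
import Literature.NumberTheory.GaloisRepresentations.GaloisRep
import Literature.NumberTheory.GaloisRepresentations.AbsGaloisGroup
import Literature.NumberTheory.GaloisRepresentations.ContinuousRep
import Literature.NumberTheory.GaloisRepresentations.InducedGaloisRep
import Literature.NumberTheory.GaloisRepresentations.LabelledHodgeTateWeights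
import Literature.NumberTheory.GaloisRepresentations.ToLocalRestrictField
import Literature.NumberTheory.PAdicHodge.FontaineDpst
import Literature.FieldTheory.AlgClosed.PadicAlgClEquivComplex
import Literature.Barriers.Langlands.TaylorWilesNumericalCoincidence
import Summits.Langlands.Langlands.Theorems.InsolubleInduction

set_option linter.dupNamespace false

/-! # InsolubleInductionKernel — PART 2 of 2 of the tree twin of the decomp-langlands lens-6 gen-16 node `InsolubleInductionCarving`
(`--supports stmt-Langlands-27748`): the node's `Cert` section VERBATIM over PART 1 (`Theorems/InsolubleInduction.lean`): necessity of every
piece under `_root_.Langlands`, `ria_of_regularCells` (RIA kernel-dominated by the host lineage's five regular TR/CM cells RPA 33822 / CW 33398 /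
GWO 33399 / GNS 33400 / GNL 33401) and `ria_of_trcmCells`, `langlands_iff_pieces`, the reachability lemmas (`reach_of_trcm`,
`reach_of_solvableGalois_over_trcm`, `unreachable_upward`), the barrier certificate of member fields (`barrier_certificate`:
r₂ > 0, positive defect, CHT coincidence fails, no solvable Galois step to a TR/CM field), `dri_witness_not_solvableGalois`, the lens-3 shadow
`niu_of_conjugationInsoluble`, and the TR/CM halves of RIA.
-/

namespace Summit.Langlands.Langlands.Theorems.InsolubleInduction


open scoped NumberField Classical Polynomial Matrix
open Filter IsDedekindDomain Polynomial
open Literature.NumberTheory.Automorphic Literature.NumberTheory.GaloisRepresentations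
open Literature.NumberTheory.PAdicHodge
open Summit.Langlands.Langlands.Theses
open Summit.Langlands.Langlands.Theorems.PolarisationCarvingBoxes (HasSelfTwist IsPinnedGeometric PrimitiveAutomorphyWhere
  IsOfTRCMType htAt IsHTRegular IsOfPolarisedType InUnpolarisedBox HasWeightString InGappedBox IsPotentiallyOrdinary IsOfSystemType
  InAnordinarySystemBox pol_iff_box unp_iff_box cw_iff_box gwo_iff_box gns_iff_box gnl_iff_box)

namespace Cert

/-- S ⟹ automorphy in every sub-box of the primitive box (clause (B) of `Langlands`; verbatim g8–g15). -/
theorem box_of_langlands (hL : _root_.Langlands)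
    (P : ∀ (K : Type) [Field K] [NumberField K] (ℓ : ℕ) [Fact ℓ.Prime] (n : ℕ), FramedGaloisRep K (PadicAlgCl ℓ) n → Prop) :
    PrimitiveAutomorphyWhere P := by
  intro K _ _ n hcpt hn ℓ _ ι ρ hirr hgeo _ _
  obtain ⟨⟨𝓡⟩, h𝓡⟩ := hL K
  obtain ⟨π, hLalg, hcorr⟩ := (h𝓡 𝓡 n (by omega) hcpt).2 ℓ ι ρ hirr hgeo
  exact ⟨π, hLalg, hcorr.1⟩

/-- S ⟹ weak automorphy of every irreducible pinned-geometric σ of rank m ≥ 2 over any number field (clause (B), pointwise form). -/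
theorem weaklyAutomorphic_of_langlands (hL : _root_.Langlands) {F : Type} [Field F] [NumberField F] {ℓ : ℕ} [Fact ℓ.Prime]
    (ι : PadicAlgCl ℓ ≃+* ℂ) {m : ℕ} (hm : 2 ≤ m) (hcpt : isCompact_glFiniteIntegralLevel m F) (σ : FramedGaloisRep F (PadicAlgCl ℓ) m)
    (hirr : σ.toGaloisRep.IsIrreducible) (hgeo : IsPinnedGeometric σ) : WeaklyAutomorphic ι hcpt σ := by
  obtain ⟨⟨𝓡⟩, h𝓡⟩ := hL F
  obtain ⟨π, hLalg, hcorr⟩ := (h𝓡 𝓡 m (by omega) hcpt).2 ℓ ι σ hirr hgeo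
  exact ⟨π, hLalg, hcorr.1⟩

/-- **S ⟹ RIA** (NECESSARY; WEAKER than S): the avatar σ is an irreducible pinned-geometric representation of rank m ≥ 2 over the number
field F₀, so clause (B) of `Langlands` over F₀ gives its weak automorphy — regularity, the summand relation and the box are not even used. -/
theorem ria_of_langlands (hL : _root_.Langlands) : RegularInsolubleAvatarAutomorphy := by
  rw [ria_iff]
  intro K _ _ n hcpt hn ℓ _ ι ρ _ _ _ _ F₀ _ _ _ _ d hd _ _ m hcpt₀ hm σ hσirr hσgeo _ _ _
  exact weaklyAutomorphic_of_langlands hL ι hm hcpt₀ σ hσirr hσgeo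

/-! ### RIA is the host lineage's business: domination BY NAME by the regular TR/CM cells of `PolarisationCarving` (rev 6) -/

/-- SAT membership of a pinned-geometric σ over a TR/CM field: the trivial sandwich L = K₀ = F₀, ρ₀ = σ, χ = 1. -/
theorem isOfTRCMType_of_trcm {F₀ : Type} [Field F₀] [NumberField F₀] {ℓ : ℕ} [Fact ℓ.Prime] {m : ℕ}
    (hTC : NumberField.IsTotallyReal F₀ ∨ NumberField.IsCMField F₀) (σ : FramedGaloisRep F₀ (PadicAlgCl ℓ) m)
    (hgeo : IsPinnedGeometric σ) : IsOfTRCMType σ := by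
  have hsub : Subsingleton (F₀ ≃ₐ[F₀] F₀) := ⟨fun a b => AlgEquiv.ext fun x => (a.commutes x).trans (b.commutes x).symm⟩
  have hsolv : IsSolvable (F₀ ≃ₐ[F₀] F₀) := isSolvable_of_comm fun a b => Subsingleton.elim _ _
  have hgal : IsGalois F₀ F₀ := inferInstance
  have htr1 : ∀ g : Field.absoluteGaloisGroup F₀, FramedRep.trace (1 : FramedGaloisRep F₀ (PadicAlgCl ℓ) 1) g = 1 := by
    intro g
    show Matrix.trace (((1 : FramedGaloisRep F₀ (PadicAlgCl ℓ) 1) g : GL (Fin 1) (PadicAlgCl ℓ)) : Matrix (Fin 1) (Fin 1) (PadicAlgCl ℓ)) = 1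
    have h1 : ((1 : FramedGaloisRep F₀ (PadicAlgCl ℓ) 1) g : GL (Fin 1) (PadicAlgCl ℓ)) = 1 := rfl
    rw [h1, Units.val_one, Matrix.trace_one, Fintype.card_fin, Nat.cast_one]
  exact ⟨F₀, inferInstance, inferInstance, inferInstance, hgal, hsolv, F₀, inferInstance, inferInstance, inferInstance, hgal, hsolv, σ, 1,
    hgeo, hTC, fun g => by rw [htr1, one_mul]⟩

/-- Node-local bridge (the landed module has the other six): RPA `PolarisationCarving.RegularPolarisedAutomorphy` (33822) ↔ box TOP ∧ REG. -/
theorem rpa_iff_box :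
    PolarisationCarving.RegularPolarisedAutomorphy ↔
      PrimitiveAutomorphyWhere fun K _ _ ℓ _ n ρ => IsOfPolarisedType (K := K) (ℓ := ℓ) (n := n) ρ ∧ IsHTRegular (K := K) (ℓ := ℓ) (n := n) ρ :=
  Iff.rfl

/-- A regular irreducible pinned-geometric twist-primitive σ of rank m ≥ 2 over a TR/CM field is weakly automorphic GIVEN the five regular
TR/CM cells of `PolarisationCarving` (four excluded middles on the landed dials TOP / weight string / ORD / SYS). -/
theorem weaklyAutomorphic_of_regularCells
    (hRPA : PolarisationCarving.RegularPolarisedAutomorphy) (hCW : PolarisationCarving.ConsecutiveWeightAutomorphy)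
    (hGWO : PolarisationCarving.GappedOrdinaryAutomorphy) (hGNS : PolarisationCarving.GappedNonOrdinarySystemAutomorphy)
    (hGNL : PolarisationCarving.GappedNonOrdinaryLoneAutomorphy)
    {F₀ : Type} [Field F₀] [NumberField F₀] (hTC : NumberField.IsTotallyReal F₀ ∨ NumberField.IsCMField F₀)
    {ℓ : ℕ} [Fact ℓ.Prime] (ι : PadicAlgCl ℓ ≃+* ℂ) {m : ℕ} (hm : 2 ≤ m) (hcpt₀ : isCompact_glFiniteIntegralLevel m F₀)
    (σ : FramedGaloisRep F₀ (PadicAlgCl ℓ) m) (hirr : σ.toGaloisRep.IsIrreducible) (hgeo : IsPinnedGeometric σ)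
    (htw : ¬ HasSelfTwist σ) (hreg : IsHTRegular σ) : WeaklyAutomorphic ι hcpt₀ σ := by
  have hSAT : IsOfTRCMType σ := isOfTRCMType_of_trcm hTC σ hgeo
  by_cases hTOP : IsOfPolarisedType σ
  · exact (rpa_iff_box.1 hRPA) F₀ m hcpt₀ hm ℓ ι σ hirr hgeo htw ⟨hTOP, hreg⟩
  have hUNP : InUnpolarisedBox σ := ⟨hTOP, hSAT⟩
  by_cases hWS : HasWeightString σ
  · exact (cw_iff_box.1 hCW) F₀ m hcpt₀ hm ℓ ι σ hirr hgeo htw ⟨hUNP, hWS⟩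
  have hGAP : InGappedBox σ := ⟨hUNP, hreg, hWS⟩
  by_cases hORD : IsPotentiallyOrdinary σ
  · exact (gwo_iff_box.1 hGWO) F₀ m hcpt₀ hm ℓ ι σ hirr hgeo htw ⟨hGAP, hORD⟩
  by_cases hSYS : IsOfSystemType σ
  · exact (gns_iff_box.1 hGNS) F₀ m hcpt₀ hm ℓ ι σ hirr hgeo htw ⟨hGAP, hORD, hSYS⟩
  · exact (gnl_iff_box.1 hGNL) F₀ m hcpt₀ hm ℓ ι σ hirr hgeo htw ⟨hGAP, hORD, hSYS⟩

/-- The same given only the two layer-1 TR/CM cells PTA (32056) and UTA (32055) (coarse form; regularity not even used). -/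
theorem weaklyAutomorphic_of_trcmCells
    (hPTA : PolarisationCarving.PolarisedTypeAutomorphy) (hUTA : PolarisationCarving.UnpolarisedTRCMTypeAutomorphy)
    {F₀ : Type} [Field F₀] [NumberField F₀] (hTC : NumberField.IsTotallyReal F₀ ∨ NumberField.IsCMField F₀)
    {ℓ : ℕ} [Fact ℓ.Prime] (ι : PadicAlgCl ℓ ≃+* ℂ) {m : ℕ} (hm : 2 ≤ m) (hcpt₀ : isCompact_glFiniteIntegralLevel m F₀)
    (σ : FramedGaloisRep F₀ (PadicAlgCl ℓ) m) (hirr : σ.toGaloisRep.IsIrreducible) (hgeo : IsPinnedGeometric σ)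
    (htw : ¬ HasSelfTwist σ) : WeaklyAutomorphic ι hcpt₀ σ := by
  by_cases hTOP : IsOfPolarisedType σ
  · exact (pol_iff_box.1 hPTA) F₀ m hcpt₀ hm ℓ ι σ hirr hgeo htw hTOP
  · exact (unp_iff_box.1 hUTA) F₀ m hcpt₀ hm ℓ ι σ hirr hgeo htw ⟨hTOP, isOfTRCMType_of_trcm hTC σ hgeo⟩

/-- **RIA ⟸ the five REGULAR TR/CM cells of `PolarisationCarving`, BY NAME** (RPA 33822, CW 33398, GWO 33399, GNS 33400, GNL 33401):
RIA is not new work — it is dominated by already-filed open items of the host lineage; this route does not staff it. -/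
theorem ria_of_regularCells
    (hRPA : PolarisationCarving.RegularPolarisedAutomorphy) (hCW : PolarisationCarving.ConsecutiveWeightAutomorphy)
    (hGWO : PolarisationCarving.GappedOrdinaryAutomorphy) (hGNS : PolarisationCarving.GappedNonOrdinarySystemAutomorphy)
    (hGNL : PolarisationCarving.GappedNonOrdinaryLoneAutomorphy) : RegularInsolubleAvatarAutomorphy := by
  rw [ria_iff]
  intro K _ _ n hcpt hn ℓ _ ι ρ _ _ _ _ F₀ _ _ _ _ d hd hTC _ m hcpt₀ hm σ hσirr hσgeo hσtw hσreg _
  exact weaklyAutomorphic_of_regularCells hRPA hCW hGWO hGNS hGNL hTC ι hm hcpt₀ σ hσirr hσgeo hσtw hσreg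

/-- **RIA ⟸ PTA ∧ UTA** (the two layer-1 TR/CM cells 32056, 32055 of `PolarisationCarving`), coarse form of the domination. -/
theorem ria_of_trcmCells
    (hPTA : PolarisationCarving.PolarisedTypeAutomorphy) (hUTA : PolarisationCarving.UnpolarisedTRCMTypeAutomorphy) :
    RegularInsolubleAvatarAutomorphy := by
  rw [ria_iff]
  intro K _ _ n hcpt hn ℓ _ ι ρ _ _ _ _ F₀ _ _ _ _ d hd hTC _ m hcpt₀ hm σ hσirr hσgeo hσtw _ _
  exact weaklyAutomorphic_of_trcmCells hPTA hUTA hTC ι hm hcpt₀ σ hσirr hσgeo hσtw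

/-- S ⟹ IFD (trivially: its conclusion is clause (B) for ρ over K). -/
theorem ifd_of_langlands (hL : _root_.Langlands) : InsolubleFibreDescent :=
  ifd_of_unr (box_of_langlands hL _)
/-- S ⟹ NIU. -/
theorem niu_of_langlands (hL : _root_.Langlands) : NonInducedUnreachableAutomorphy := box_of_langlands hL _
/-- S ⟹ DIU. -/
theorem diu_of_langlands (hL : _root_.Langlands) : DirectlyInducedUnreachableAutomorphy := box_of_langlands hL _
/-- S ⟹ UNR (the target itself is S-implied). -/
theorem unr_of_langlands (hL : _root_.Langlands) : AnchoredInductionCarving.UnreachableDeepAutomorphy := box_of_langlands hL _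
/-- S ⟹ FRAME″ (trivially). -/
theorem frame_of_langlands (hL : _root_.Langlands) : UnreachableFrame := fun _ => hL
/-- S ⟹ Assembly (trivially). -/
theorem assembly_of_langlands (_hL : _root_.Langlands) : Assembly := closes

/-- **Langlands ⟺ RIA ∧ IFD ∧ NIU ∧ FRAME″** — the child route is exact: nothing filed is stronger than S, and the pieces give S back. -/
theorem langlands_iff_pieces :
    _root_.Langlands ↔
      (RegularInsolubleAvatarAutomorphy ∧ InsolubleFibreDescent ∧ NonInducedUnreachableAutomorphy ∧ UnreachableFrame) :=
  ⟨fun hL => ⟨ria_of_langlands hL, ifd_of_langlands hL, niu_of_langlands hL, frame_of_langlands hL⟩,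
    fun h => closes h.1 h.2.1 h.2.2.1 h.2.2.2⟩

/-- UNR ⟺ (RIA-free form) IFD ∧ NIU ∧ DIU; with RIA the attacked cell needs only IFD: UNR ⟸ RIA ∧ IFD ∧ NIU (= `closes` without the frame). -/
theorem unr_of_pieces (hRIA : RegularInsolubleAvatarAutomorphy) (hIFD : InsolubleFibreDescent) (hNIU : NonInducedUnreachableAutomorphy) :
    AnchoredInductionCarving.UnreachableDeepAutomorphy :=
  unr_of_cells (diu_of_ria_ifd hRIA hIFD) hNIU

/-! ### Field-level certificates: what «unreachable» forces (the BARRIER tags, kernel-visible) -/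

/-- A TR/CM field presented over ITSELF is reachable (L = K₀ = F₀ = K; both Galois steps trivial). -/
theorem reach_of_trcm {K : Type} [Field K] [NumberField K] (h : NumberField.IsTotallyReal K ∨ NumberField.IsCMField K) :
    SolvablyReachable K := by
  have hsub : Subsingleton (K ≃ₐ[K] K) := ⟨fun a b => AlgEquiv.ext fun x => (a.commutes x).trans (b.commutes x).symm⟩
  have hsolv : IsSolvable (K ≃ₐ[K] K) := isSolvable_of_comm fun a b => Subsingleton.elim _ _
  exact ⟨K, ‹_›, ‹_›, Algebra.id K, K, ‹_›, ‹_›, Algebra.id K, inferInstance, hsolv, K, ‹_›, ‹_›, Algebra.id K, inferInstance, hsolv, h⟩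

/-- A field that is solvable-Galois over a TR/CM SUBFIELD F₀ is reachable (L = K₀ = K, one genuine step K/F₀). -/
theorem reach_of_solvableGalois_over_trcm {K : Type} [Field K] [NumberField K]
    (h : ∃ (F₀ : Type) (_ : Field F₀) (_ : NumberField F₀) (_ : Algebra F₀ K),
      IsGalois F₀ K ∧ IsSolvable (K ≃ₐ[F₀] K) ∧ (NumberField.IsTotallyReal F₀ ∨ NumberField.IsCMField F₀)) :
    SolvablyReachable K := by
  obtain ⟨F₀, _, _, _, hG, hS, hTC⟩ := h
  have hsub : Subsingleton (K ≃ₐ[K] K) := ⟨fun a b => AlgEquiv.ext fun x => (a.commutes x).trans (b.commutes x).symm⟩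
  have hsolv : IsSolvable (K ≃ₐ[K] K) := isSolvable_of_comm fun a b => Subsingleton.elim _ _
  exact ⟨K, ‹_›, ‹_›, Algebra.id K, K, ‹_›, ‹_›, Algebra.id K, inferInstance, hsolv, F₀, ‹_›, ‹_›, ‹_›, hG, hS, hTC⟩

/-- **(SI) placement, kernel form.** Over an UNREACHABLE K, no totally real or CM subfield F₀ ⊆ K presents K as a Galois extension with
solvable group: every presentation K/F₀ over a TR/CM subfield is non-normal or has insoluble group — so the descent IFD asks for is OUTSIDE
the solvable base-change / automorphic-induction theorems [ArthurClozel1989] by construction (`SolvableImageBarrier` technique class head-on). -/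
theorem not_solvableGalois_over_trcm_of_unreachable {K : Type} [Field K] [NumberField K] (hK : ¬ SolvablyReachable K)
    (F₀ : Type) [Field F₀] [NumberField F₀] [Algebra F₀ K] (hTC : NumberField.IsTotallyReal F₀ ∨ NumberField.IsCMField F₀) :
    ¬ (IsGalois F₀ K ∧ IsSolvable (K ≃ₐ[F₀] K)) :=
  fun h => hK (reach_of_solvableGalois_over_trcm ⟨F₀, ‹_›, ‹_›, ‹_›, h.1, h.2, hTC⟩)

/-- An unreachable field is not totally real … -/
theorem not_isTotallyReal_of_unreachable {K : Type} [Field K] [NumberField K] (hK : ¬ SolvablyReachable K) :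
    ¬ NumberField.IsTotallyReal K :=
  fun h => hK (reach_of_trcm (Or.inl h))

/-- … and not CM. -/
theorem not_isCMField_of_unreachable {K : Type} [Field K] [NumberField K] (hK : ¬ SolvablyReachable K) :
    ¬ NumberField.IsCMField K :=
  fun h => hK (reach_of_trcm (Or.inr h))

/-- **(Sh) placement, kernel form**: an unreachable K has a COMPLEX PLACE (r₂ > 0) — so Res_{K/ℚ} GL_n (n ≥ 2) has no discrete series
at infinity and no Shimura-variety realisation [`Literature.Barriers.Langlands.ShimuraVarietyRealizationBarrier`: `equalRankResGL_iff`,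
`not_equalRankResGL_of_not_isTotallyReal`], and the same holds at every field solvably around or above K (`unreachable_upward`). -/
theorem complexPlaces_pos_of_unreachable {K : Type} [Field K] [NumberField K] (hK : ¬ SolvablyReachable K) :
    0 < NumberField.InfinitePlace.nrComplexPlaces K :=
  Nat.pos_of_ne_zero fun h => not_isTotallyReal_of_unreachable hK (NumberField.nrComplexPlaces_eq_zero_iff.mp h)

/-- **(TWα) placement, kernel form** [`Literature.Barriers.Langlands.TaylorWilesNumericalCoincidence`]: over an unreachable K the
Khare–Thorne / Calegari–Geraghty defect `defectGL r₁ r₂ n = r₁⌊(n−1)/2⌋ + r₂(n−1)` of Res_{K/ℚ} GL_n is POSITIVE for every n ≥ 2 … -/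
theorem defectGL_pos_of_unreachable {K : Type} [Field K] [NumberField K] (hK : ¬ SolvablyReachable K) {n : ℕ} (hn : 2 ≤ n) :
    0 < Literature.Barriers.Langlands.defectGL (NumberField.InfinitePlace.nrRealPlaces K) (NumberField.InfinitePlace.nrComplexPlaces K) n := by
  have hr := complexPlaces_pos_of_unreachable hK
  have h : 0 < NumberField.InfinitePlace.nrComplexPlaces K * (n - 1) := Nat.mul_pos hr (by omega)
  unfold Literature.Barriers.Langlands.defectGL
  omega

/-- … equivalently the Clozel–Harris–Taylor numerical coincidence FAILS for every archimedean datum of an n-dimensional ρ over K, n ≥ 2,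
whatever the signs at the real places (`not_chtCoincidenceGL_of_complexPlace`): classical Taylor–Wiles patching over K is unavailable. -/
theorem not_chtCoincidenceGL_of_unreachable {K : Type} [Field K] [NumberField K] (hK : ¬ SolvablyReachable K) {n : ℕ} (hn : 2 ≤ n)
    (plusMult : Fin (NumberField.InfinitePlace.nrRealPlaces K) → ℕ) (hle : ∀ v, plusMult v ≤ n) :
    ¬ Literature.Barriers.Langlands.CHTCoincidenceGL
      (⟨NumberField.InfinitePlace.nrRealPlaces K, NumberField.InfinitePlace.nrComplexPlaces K, plusMult, hle,
        Nat.lt_of_lt_of_le (complexPlaces_pos_of_unreachable hK) (Nat.le_add_left _ _)⟩ : Literature.Barriers.Langlands.ArchData n) :=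
  Literature.Barriers.Langlands.not_chtCoincidenceGL_of_complexPlace _ hn (complexPlaces_pos_of_unreachable hK)

/-- **Upward closure**: every number field containing an unreachable field is unreachable (compose the embedding into the witness tower).
Hence POTENTIAL automorphy (automorphy of ρ|_{Γ_M} over a finite extension M/K) never leaves the cell: M is again unreachable, again with a
complex place, again in positive defect. -/
theorem unreachable_upward {K M : Type} [Field K] [NumberField K] [Field M] [NumberField M] [Algebra K M]
    (hK : ¬ SolvablyReachable K) : ¬ SolvablyReachable M := by
  rintro ⟨L, iF, iN, iA, K₀, iF₀, iN₀, iA₀, hG₀, hS₀, F₀, jF, jN, jA, hG, hS, hTC⟩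
  exact hK ⟨L, iF, iN, ((algebraMap M L).comp (algebraMap K M)).toAlgebra, K₀, iF₀, iN₀, iA₀, hG₀, hS₀, F₀, jF, jN, jA, hG, hS, hTC⟩

/-- **The barrier certificate of a member field, bundled**: K unreachable ⇒ (Sh) a complex place ∧ (TWα) positive defect for n ≥ 2 ∧ (SI) no
solvable-Galois presentation over any TR/CM subfield ∧ (V1) every finite extension is again unreachable. -/
theorem barrier_certificate {K : Type} [Field K] [NumberField K] (hK : ¬ SolvablyReachable K) {n : ℕ} (hn : 2 ≤ n) :
    0 < NumberField.InfinitePlace.nrComplexPlaces K ∧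
      0 < Literature.Barriers.Langlands.defectGL (NumberField.InfinitePlace.nrRealPlaces K) (NumberField.InfinitePlace.nrComplexPlaces K) n ∧
      (∀ (F₀ : Type) [Field F₀] [NumberField F₀] [Algebra F₀ K],
        (NumberField.IsTotallyReal F₀ ∨ NumberField.IsCMField F₀) → ¬ (IsGalois F₀ K ∧ IsSolvable (K ≃ₐ[F₀] K))) ∧
      ∀ (M : Type) [Field M] [NumberField M] [Algebra K M], ¬ SolvablyReachable M :=
  ⟨complexPlaces_pos_of_unreachable hK, defectGL_pos_of_unreachable hK hn,
    fun F₀ _ _ _ hTC => not_solvableGalois_over_trcm_of_unreachable hK F₀ hTC, fun _M _ _ _ => unreachable_upward hK⟩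

/-- In the DIU cell the dial's subfield F₀ is a TR/CM subfield over which K is NOT solvable-Galois: the fibre descent IFD is genuinely insoluble
or non-normal for every witness of DRI (the (SI) wall, stated on the cell's own data). -/
theorem dri_witness_not_solvableGalois {K : Type} [Field K] [NumberField K] {ℓ : ℕ} [Fact ℓ.Prime] {n : ℕ}
    {ρ : FramedGaloisRep K (PadicAlgCl ℓ) n} (h : UnrBox ρ ∧ InducesRegularlyToSubfield ρ) :
    ∃ (F₀ : Type) (_ : Field F₀) (_ : NumberField F₀) (_ : Algebra F₀ K) (_ : FiniteDimensional F₀ K) (d : ℕ)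
      (hd : Module.finrank F₀ K = d),
      (NumberField.IsTotallyReal F₀ ∨ NumberField.IsCMField F₀) ∧ IsHTRegular (ρ.induce F₀ hd) ∧
        ¬ (IsGalois F₀ K ∧ IsSolvable (K ≃ₐ[F₀] K)) := by
  obtain ⟨⟨_, hK⟩, F₀, iF, iN, iA, iFD, d, hd, hTC, hreg⟩ := h
  exact ⟨F₀, iF, iN, iA, iFD, d, hd, hTC, hreg, not_solvableGalois_over_trcm_of_unreachable hK F₀ hTC⟩

/-! ### Cross-lens nesting: NIU ⊂ UNR ⊂ B_CI (lens-3-g7's dark residual), pure logic -/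

/-- Conjugation-soluble (lens-3-g7's ∃-clause VERBATIM) ⇒ solvably reachable (g15 verbatim). -/
theorem reach_of_conjSoluble {K : Type} [Field K] [NumberField K]
    (h : ∃ (F₀ E : Type) (_ : Field F₀) (_ : NumberField F₀) (_ : Field E) (_ : NumberField E) (_ : Algebra F₀ K) (_ : Algebra K E)
      (_ : Algebra F₀ E) (_ : IsScalarTower F₀ K E) (_ : IsGalois F₀ E), NumberField.IsTotallyReal F₀ ∧ IsSolvable (E ≃ₐ[F₀] E)) :
    SolvablyReachable K := by
  obtain ⟨F₀, E, _, _, _, _, _, _, _, _, hGal, hTR, hsolv⟩ := h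
  exact ⟨E, ‹_›, ‹_›, ‹_›, E, ‹_›, ‹_›, Algebra.id E, inferInstance, inferInstance, F₀, ‹_›, ‹_›, ‹_›, hGal, hsolv, Or.inl hTR⟩

/-- **B_CI ⟹ UNR ⟹ NIU**: lens-3-g7's `WeilRestrictionSplit.ConjugationInsolubleAutomorphy` gives the declared residual NIU of this node
(an unreachable K is conjugation-insoluble; NIU's hypotheses are a superset) — the residual is ONE dark statement across lenses 3 and 6. -/
theorem niu_of_conjugationInsoluble (h : WeilRestrictionSplit.ConjugationInsolubleAutomorphy) : NonInducedUnreachableAutomorphy := by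
  intro K _ _ n hcpt hn ℓ _ ι ρ hirr hgeo _htw hbox
  exact h K (fun hcs => hbox.1.2 (reach_of_conjSoluble hcs)) n hcpt (by omega) ℓ ι ρ hirr hgeo

/-! ### BC3-shape skeleton of the attacked conjunct inside the node (both halves S-implied): RIA by target type -/

/-- RIA restricted to TOTALLY REAL subfields F₀ (engine: [ACC2023 Thm 6.1.2] / BLGGT if the summand happens to be polarised) … -/
def AvatarAutomorphyTR : Prop :=
  PrimitiveWhere
    (fun K _ _ ℓ _ n ρ => UnrBox (K := K) (ℓ := ℓ) (n := n) ρ ∧ InducesRegularlyToSubfield (K := K) (ℓ := ℓ) (n := n) ρ)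
    (fun K _ _ ℓ _ _ ι _ ρ =>
      ∀ (F₀ : Type) [Field F₀] [NumberField F₀] [Algebra F₀ K] [FiniteDimensional F₀ K] (d : ℕ) (hd : Module.finrank F₀ K = d),
        NumberField.IsTotallyReal F₀ → IsHTRegular (ρ.induce F₀ hd) →
        ∀ (m : ℕ) (hcpt₀ : isCompact_glFiniteIntegralLevel m F₀), 2 ≤ m →
          ∀ (σ : FramedGaloisRep F₀ (PadicAlgCl ℓ) m), σ.toGaloisRep.IsIrreducible → IsPinnedGeometric σ → ¬ HasSelfTwist σ →
            IsHTRegular σ → IsTraceSummand σ (ρ.induce F₀ hd) → WeaklyAutomorphic ι hcpt₀ σ)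

/-- … and to CM subfields («the ten-author cell» proper: [ACC2023 Thm 6.1.1], [MiagkovThorne2023], potential version [Qian2022]). -/
def AvatarAutomorphyCM : Prop :=
  PrimitiveWhere
    (fun K _ _ ℓ _ n ρ => UnrBox (K := K) (ℓ := ℓ) (n := n) ρ ∧ InducesRegularlyToSubfield (K := K) (ℓ := ℓ) (n := n) ρ)
    (fun K _ _ ℓ _ _ ι _ ρ =>
      ∀ (F₀ : Type) [Field F₀] [NumberField F₀] [Algebra F₀ K] [FiniteDimensional F₀ K] (d : ℕ) (hd : Module.finrank F₀ K = d),
        NumberField.IsCMField F₀ → IsHTRegular (ρ.induce F₀ hd) →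
        ∀ (m : ℕ) (hcpt₀ : isCompact_glFiniteIntegralLevel m F₀), 2 ≤ m →
          ∀ (σ : FramedGaloisRep F₀ (PadicAlgCl ℓ) m), σ.toGaloisRep.IsIrreducible → IsPinnedGeometric σ → ¬ HasSelfTwist σ →
            IsHTRegular σ → IsTraceSummand σ (ρ.induce F₀ hd) → WeaklyAutomorphic ι hcpt₀ σ)

/-- RIA ⟸ (TR half) ∧ (CM half): case split on the type of the subfield. -/
theorem ria_of_halves (hTR : AvatarAutomorphyTR) (hCM : AvatarAutomorphyCM) : RegularInsolubleAvatarAutomorphy := by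
  rw [ria_iff]
  intro K _ _ n hcpt hn ℓ _ ι ρ hirr hgeo htw hbox F₀ _ _ _ _ d hd hTC hreg m hcpt₀ hm σ hσirr hσgeo hσtw hσreg hsum
  rcases hTC with hT | hC
  · exact hTR K n hcpt hn ℓ ι ρ hirr hgeo htw hbox F₀ d hd hT hreg m hcpt₀ hm σ hσirr hσgeo hσtw hσreg hsum
  · exact hCM K n hcpt hn ℓ ι ρ hirr hgeo htw hbox F₀ d hd hC hreg m hcpt₀ hm σ hσirr hσgeo hσtw hσreg hsum

/-- … and conversely RIA gives both halves, so RIA ⟺ TR-half ∧ CM-half (exact). -/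
theorem halves_of_ria (h : RegularInsolubleAvatarAutomorphy) : AvatarAutomorphyTR ∧ AvatarAutomorphyCM := by
  rw [ria_iff] at h
  exact ⟨fun K _ _ n hcpt hn ℓ _ ι ρ hirr hgeo htw hbox F₀ _ _ _ _ d hd hT =>
      h K n hcpt hn ℓ ι ρ hirr hgeo htw hbox F₀ d hd (Or.inl hT),
    fun K _ _ n hcpt hn ℓ _ ι ρ hirr hgeo htw hbox F₀ _ _ _ _ d hd hC =>
      h K n hcpt hn ℓ ι ρ hirr hgeo htw hbox F₀ d hd (Or.inr hC)⟩

/-- Both halves are S-implied (the skeleton files nothing beyond S). -/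
theorem halves_of_langlands (hL : _root_.Langlands) : AvatarAutomorphyTR ∧ AvatarAutomorphyCM :=
  halves_of_ria (ria_of_langlands hL)

end Cert

end Summit.Langlands.Langlands.Theorems.InsolubleInduction
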